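import Mathlib
import Summits.Ventures.PercRepro2.CrossAPrimeCoinMarkSplit

/-!
# The coin at a mark, II: the signs
(blind cell PercRepro2, p5 g38; `proofs/subclaims/S4-HARDSTEP.md` §2.4 (s) addendum 46 (3))

With the exact split `Φ₀₁ + Φ₁₀ = crossC(p⁰; c) + x⁰·Dv⁰ + t⁰·(c·x⁰ − xv⁰) + CROSS` of
`CrossAPrimeCoinMarkSplit` (`coin_mark_mid_eq`) along the coin `e = {a₂, o}`:

* **`type2_vL_le_mul`**: `Zv₂′ ≤ c·Z₂′` — the admissibility bound for the EXPLORED event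
  «type 2» (`prob_Q_vL_le_mul_explored`);
* **`coin_mark_T1T4_nonneg`**: `(y¹ − y⁰)(c·x⁰ − xv⁰) + y⁰(c·Z¹ − Zv¹) ≥ 0`;
* **`coin_mark_uptilt`**: the up-set tilt `2Φ(m⁰, m⁰|_{o ∈ K})` at `{K ∋ o}` equals
  `crossC(p⁰; c) + x⁰·Dv⁰ + t⁰·(c·x⁰ − xv⁰) ≥ crossC(p⁰; c)` — a theorem modulo the induction
  hypothesis of `A2Step`;
* **`a2Step_coin_mark_of_cross`**: `0 ≤ crossC(p⁰; c) → 0 ≤ CROSS → 0 ≤ Φ₀₁ + Φ₁₀`.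

`CROSS ≥ 0` (the two-law form between the closed-coin law and the grown clusters) is census-true
(kit j336436: 2,560 / 2,560 at `c = π` and at `c = sup g`) and not claimed here.  Own work;
standard axioms.
-/

namespace Summit.Ventures.PercRepro2

open LeafRowPendantRootSO CrossAPrimeSupport CrossAPrimeA2Route CrossAPrimeA2Induction
  CrossAPrimeExploredBound

namespace CrossAPrimeCoinMark

section Signs

variable {V : Type*} {E : Type*} [Fintype E] [DecidableEq E] [Fintype V] [DecidableEq V]
  {R : Type*} [Field R] [LinearOrder R] [IsStrictOrderedRing R]
variable {ends : E → Sym2 V}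

omit [DecidableEq V] in
/-- **The type-2 admissibility bound**: `Zv₂′ ≤ c·Z₂′` for the coin `e = {a₂, o}`. -/
theorem type2_vL_le_mul {p : E → R} (hp : IsProbVec p) {c : R} {a₁ a₂ v : V}
    (hadm : Adm p c ends a₁ a₂ v) {e : E} {o : V} (hends : ends e = s(a₂, o)) :
    prob (Function.update p e 1) ((avoidAll ends a₂ {a₁} ∩ connEvent ends a₁ v) ∩
        {ω | o ∉ cluster ends (Function.update ω e false) a₂}) ≤
      c * prob (Function.update p e 1) (avoidAll ends a₂ {a₁} ∩
        {ω | o ∉ cluster ends (Function.update ω e false) a₂}) := by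
  have hp1 : IsProbVec (Function.update p e 1) := hp.update e zero_le_one le_rfl
  have he : e ∈ touches ends (cluster ends (sureConfig p) a₂) :=
    ⟨a₂, mem_cluster_self ends _ a₂, o, hends⟩
  have hadm1 : Adm (Function.update p e 1) c ends a₁ a₂ v := adm_update_one hadm he
  have hA := exploredEvent_notMem_cluster_update (ends := ends) a₂ o e
  have key := prob_Q_vL_le_mul_explored hp1 hadm1 hA
  have e1 : {ω : Config E | o ∉ cluster ends (Function.update ω e false) a₂} ∩
      connEvent ends a₁ v ∩ avoidAll ends a₂ {a₁} =
      (avoidAll ends a₂ {a₁} ∩ connEvent ends a₁ v) ∩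
        {ω | o ∉ cluster ends (Function.update ω e false) a₂} := by
    ext ω
    simp only [Set.mem_inter_iff]
    tauto
  have e2 : {ω : Config E | o ∉ cluster ends (Function.update ω e false) a₂} ∩
      avoidAll ends a₂ {a₁} = avoidAll ends a₂ {a₁} ∩
        {ω | o ∉ cluster ends (Function.update ω e false) a₂} := Set.inter_comm _ _
  rw [e1, e2] at key
  exact key

omit [DecidableEq V] in
/-- **`T₁ + T₄ ≥ 0`**: `(y¹ − y⁰)(c·x⁰ − xv⁰) + y⁰(c·Z¹ − Zv¹) ≥ 0` along the coin `e = {a₂, o}`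
(`c` admissible, `e` random). -/
theorem coin_mark_T1T4_nonneg {p : E → R} (hp : IsProbVec p) {c : R} {a₁ a₂ v : V}
    (hadm : Adm p c ends a₁ a₂ v) {e : E} {o : V} (hends : ends e = s(a₂, o)) (h1 : p e ≠ 1)
    (b : V) :
    0 ≤ (prob (Function.update p e 1) (avoidAll ends a₂ {a₁} ∩ connEvent ends a₂ b) -
          prob (Function.update p e 0) (avoidAll ends a₂ {a₁} ∩ connEvent ends a₂ b)) *
        (c * prob (Function.update p e 0) (avoidAll ends a₂ {a₁} ∩ connEvent ends a₂ o) -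
          prob (Function.update p e 0)
            (avoidAll ends a₂ {a₁} ∩ (connEvent ends a₁ v ∩ connEvent ends a₂ o))) +
      prob (Function.update p e 0) (avoidAll ends a₂ {a₁} ∩ connEvent ends a₂ b) *
        (c * prob (Function.update p e 1) (avoidAll ends a₂ {a₁}) -
          prob (Function.update p e 1) (avoidAll ends a₂ {a₁} ∩ connEvent ends a₁ v)) := by
  have hp0 : IsProbVec (Function.update p e 0) := hp.update e le_rfl zero_le_one
  have hp1 : IsProbVec (Function.update p e 1) := hp.update e zero_le_one le_rfl
  have he : e ∈ touches ends (cluster ends (sureConfig p) a₂) :=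
    ⟨a₂, mem_cluster_self ends _ a₂, o, hends⟩
  have hadm0 : Adm (Function.update p e 0) c ends a₁ a₂ v := adm_update_zero hadm he h1
  obtain ⟨hQ, hQb, hQv, -⟩ := flip_mass_events hends a₁ v b
  have sQ := prob_update_one_split p hQ
  have sQb := prob_update_one_split p hQb
  have sQv := prob_update_one_split p hQv
  -- `xv⁰ ≤ c·x⁰`
  have hx : prob (Function.update p e 0)
      (avoidAll ends a₂ {a₁} ∩ (connEvent ends a₁ v ∩ connEvent ends a₂ o)) ≤
      c * prob (Function.update p e 0) (avoidAll ends a₂ {a₁} ∩ connEvent ends a₂ o) := by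
    have h := CrossAPrimeA2VEdge.prob_Q_vL_le_mul hp0 hadm0 {A : Set V | o ∈ A}
    have e1 : clusterInEvent ends a₂ {A : Set V | o ∈ A} ∩ connEvent ends a₁ v ∩
        avoidAll ends a₂ {a₁} =
        avoidAll ends a₂ {a₁} ∩ (connEvent ends a₁ v ∩ connEvent ends a₂ o) := by
      ext ω
      simp only [Set.mem_inter_iff, clusterInEvent, Set.mem_setOf_eq, mem_cluster, connEvent]
      tauto
    have e2 : clusterInEvent ends a₂ {A : Set V | o ∈ A} ∩ avoidAll ends a₂ {a₁} =
        avoidAll ends a₂ {a₁} ∩ connEvent ends a₂ o := by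
      ext ω
      simp only [Set.mem_inter_iff, clusterInEvent, Set.mem_setOf_eq, mem_cluster, connEvent]
      tauto
    rw [e1, e2] at h
    exact h
  have hz := type2_vL_le_mul hp hadm hends
  have e3 : avoidAll ends a₂ {a₁} ∩ connEvent ends a₁ v ∩ connEvent ends a₂ o =
      avoidAll ends a₂ {a₁} ∩ (connEvent ends a₁ v ∩ connEvent ends a₂ o) := by
    rw [Set.inter_assoc]
  rw [sQ, sQb, sQv, e3]
  have hy1 := prob_nonneg hp1 ((avoidAll ends a₂ {a₁} ∩ connEvent ends a₂ b) ∩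
    {ω | o ∉ cluster ends (Function.update ω e false) a₂})
  have hy0 := prob_nonneg hp0 (avoidAll ends a₂ {a₁} ∩ connEvent ends a₂ b)
  have ht0 := prob_nonneg hp0 (avoidAll ends a₂ {a₁} ∩ connEvent ends a₂ b ∩ connEvent ends a₂ o)
  have k1 := mul_nonneg hy1 (sub_nonneg.2 hx)
  have k2 := mul_nonneg hy0 (sub_nonneg.2 hz)
  have k3 := mul_nonneg ht0 (sub_nonneg.2 hx)
  nlinarith [k1, k2, k3]

omit [DecidableEq V] in
/-- **The up-set tilt at `{K ∋ o}` dominates the crux of `p⁰`**: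
`crossC(p⁰; c) ≤ crossC(p⁰; c) + x⁰·Dv⁰ + t⁰·(c·x⁰ − xv⁰)`. -/
theorem coin_mark_uptilt {p : E → R} (hp : IsProbVec p) {c : R} {a₁ a₂ v : V}
    (hadm : Adm p c ends a₁ a₂ v) {e : E} {o : V} (hends : ends e = s(a₂, o)) (h1 : p e ≠ 1)
    (b : V) :
    crossC (Function.update p e 0) c ends o a₁ a₂ v b ≤
      crossC (Function.update p e 0) c ends o a₁ a₂ v b +
        prob (Function.update p e 0) (avoidAll ends a₂ {a₁} ∩ connEvent ends a₂ o) *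
          prob (Function.update p e 0) (avoidAll ends a₂ {a₁} ∩
            (connEvent ends a₁ v ∩ (connEvent ends a₂ o ∩ connEvent ends a₂ b))) +
        prob (Function.update p e 0) ((avoidAll ends a₂ {a₁} ∩ connEvent ends a₂ b) ∩
            connEvent ends a₂ o) *
          (c * prob (Function.update p e 0) (avoidAll ends a₂ {a₁} ∩ connEvent ends a₂ o) -
            prob (Function.update p e 0)
              (avoidAll ends a₂ {a₁} ∩ (connEvent ends a₁ v ∩ connEvent ends a₂ o))) := by
  have hp0 : IsProbVec (Function.update p e 0) := hp.update e le_rfl zero_le_one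
  have he : e ∈ touches ends (cluster ends (sureConfig p) a₂) :=
    ⟨a₂, mem_cluster_self ends _ a₂, o, hends⟩
  have hadm0 : Adm (Function.update p e 0) c ends a₁ a₂ v := adm_update_zero hadm he h1
  have hx : prob (Function.update p e 0)
      (avoidAll ends a₂ {a₁} ∩ (connEvent ends a₁ v ∩ connEvent ends a₂ o)) ≤
      c * prob (Function.update p e 0) (avoidAll ends a₂ {a₁} ∩ connEvent ends a₂ o) := by
    have h := CrossAPrimeA2VEdge.prob_Q_vL_le_mul hp0 hadm0 {A : Set V | o ∈ A}
    have e1 : clusterInEvent ends a₂ {A : Set V | o ∈ A} ∩ connEvent ends a₁ v ∩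
        avoidAll ends a₂ {a₁} =
        avoidAll ends a₂ {a₁} ∩ (connEvent ends a₁ v ∩ connEvent ends a₂ o) := by
      ext ω
      simp only [Set.mem_inter_iff, clusterInEvent, Set.mem_setOf_eq, mem_cluster, connEvent]
      tauto
    have e2 : clusterInEvent ends a₂ {A : Set V | o ∈ A} ∩ avoidAll ends a₂ {a₁} =
        avoidAll ends a₂ {a₁} ∩ connEvent ends a₂ o := by
      ext ω
      simp only [Set.mem_inter_iff, clusterInEvent, Set.mem_setOf_eq, mem_cluster, connEvent]
      tauto
    rw [e1, e2] at h
    exact h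
  have hx0 := prob_nonneg hp0 (avoidAll ends a₂ {a₁} ∩ connEvent ends a₂ o)
  have hD := prob_nonneg hp0 (avoidAll ends a₂ {a₁} ∩
    (connEvent ends a₁ v ∩ (connEvent ends a₂ o ∩ connEvent ends a₂ b)))
  have ht0 := prob_nonneg hp0 (avoidAll ends a₂ {a₁} ∩ connEvent ends a₂ b ∩ connEvent ends a₂ o)
  have k1 := mul_nonneg hx0 hD
  have k2 := mul_nonneg ht0 (sub_nonneg.2 hx)
  linarith [k1, k2]

omit [DecidableEq V] in
/-- **The coin at a mark reduces to `CROSS ≥ 0`**: under the induction hypothesis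
`0 ≤ crossC(p⁰; c)` and `0 ≤ CROSS`, the middle coefficient along `e = {a₂, o}` is nonnegative. -/
theorem a2Step_coin_mark_of_cross {p : E → R} (hp : IsProbVec p) {c : R} {a₁ a₂ v : V}
    (hadm : Adm p c ends a₁ a₂ v) {e : E} {o : V} (hends : ends e = s(a₂, o)) (h1 : p e ≠ 1)
    (b : V) (hIH : 0 ≤ crossC (Function.update p e 0) c ends o a₁ a₂ v b)
    (hcross : 0 ≤
      prob (Function.update p e 1) ((avoidAll ends a₂ {a₁} ∩ connEvent ends a₂ b) ∩
            {ω | o ∉ cluster ends (Function.update ω e false) a₂}) *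
          (c * prob (Function.update p e 0) (avoidAll ends a₂ {a₁} ∩ connEvent ends a₂ o) -
            prob (Function.update p e 0)
              (avoidAll ends a₂ {a₁} ∩ (connEvent ends a₁ v ∩ connEvent ends a₂ o))) +
        prob (Function.update p e 0) (avoidAll ends a₂ {a₁} ∩ connEvent ends a₂ b) *
          (c * prob (Function.update p e 1) (avoidAll ends a₂ {a₁} ∩
              {ω | o ∉ cluster ends (Function.update ω e false) a₂}) -
            prob (Function.update p e 1) ((avoidAll ends a₂ {a₁} ∩ connEvent ends a₁ v) ∩
              {ω | o ∉ cluster ends (Function.update ω e false) a₂})) +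
        prob (Function.update p e 1)
            ((avoidAll ends a₂ {a₁} ∩ (connEvent ends a₁ v ∩ connEvent ends a₂ b)) ∩
              {ω | o ∉ cluster ends (Function.update ω e false) a₂}) *
          (2 * prob (Function.update p e 0) (avoidAll ends a₂ {a₁}) -
            prob (Function.update p e 0) (avoidAll ends a₂ {a₁} ∩ connEvent ends a₂ o)) +
        prob (Function.update p e 1) (avoidAll ends a₂ {a₁} ∩
            {ω | o ∉ cluster ends (Function.update ω e false) a₂}) *
          (2 * prob (Function.update p e 0) (avoidAll ends a₂ {a₁} ∩
              (connEvent ends a₁ v ∩ (connEvent ends a₂ o ∩ connEvent ends a₂ b))) -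
            prob (Function.update p e 0)
              (avoidAll ends a₂ {a₁} ∩ (connEvent ends a₁ v ∩ connEvent ends a₂ b)))) :
    0 ≤ crossPatC (Function.update p e 0) (Function.update p e 1) c ends o a₁ a₂ v b +
        crossPatC (Function.update p e 1) (Function.update p e 0) c ends o a₁ a₂ v b := by
  rw [coin_mark_mid_eq p c hends a₁ v b]
  have hup := coin_mark_uptilt hp hadm hends h1 b
  linarith [hIH, hup, hcross]

end Signs

end CrossAPrimeCoinMark

end Summit.Ventures.PercRepro2
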